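import Mathlib

/-!
# BC5 rung (toy-model analogue; T3) for crux `ScaleMonotonicity` of route `AntiScreeningCeilings`
(ym-idea-11 g4, lens wuc, leaf stmt-QuantumFields-19868). No summit / leaf / NT / UV / IR statement is proved here.

The crux says: below the onset of the floors the dimensionless on-axis mirror covariance `t⁸·|c_L(t)|` of one plaquette
orientation is quasi-non-decreasing in the separation, `t⁸|c_L(t)| ≤ A·t₂⁸|c_L(t₂)|` for `4 ≤ t ≤ t₂ ≤ 2ℓ/s + 2`
(non-perturbative ANTI-SCREENING).  At one loop `t⁸ c(t) ∝ g⁴(t)` with the running coupling `g²(t) ∝ 1 + b·log t + …`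
(`b = 2 b₀ g₀² > 0` for SU(N): asymptotic freedom); the infrared-free mirror image (4-d `φ⁴`, weakly self-avoiding walk:
Gawędzki–Kupiainen 1985, Bauerschmidt–Brydges–Slade 2014, Slade–Tomberg 2016) has the opposite sign.  The toy model below is
the one-loop SHAPE `f_b(t) = (1 + b log t)²` on `t ≥ 1`; it decides the crux's inequality exactly by the sign of `b`:

* `af_sign_monotone`     : `0 ≤ b` ⇒ `f_b t ≤ f_b t₂` for `1 ≤ t ≤ t₂` (the crux's inequality with `A = 1`);
* `irfree_sign_violates` : `b < 0` ⇒ for EVERY constant `A` some admissible pair violates `f_b t ≤ A · f_b t₂`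
  (screening kills quasi-monotonicity: the lever is Yang–Mills-specific, cf. `Literature.Barriers.QuantumFields.ScalarPhi4Triviality`).

This lies outside the known regime of the leaf (no continuum statement is touched) and exercises exactly the route's lever
(the sign of the running decides the direction of the scale transfer).
-/

namespace Summit.QuantumFields.YangMills.Cruxes.ScaleMonotonicity.Rung

/-- one-loop shape of the dimensionless mirror covariance: `(1 + b log t)²`. -/
noncomputable def oneLoopShape (b t : ℝ) : ℝ := (1 + b * Real.log t) ^ 2

/-- Asymptotically free sign (`0 ≤ b`): the shape is non-decreasing on `[1, ∞)` — the crux's inequality with `A = 1`. -/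
theorem af_sign_monotone {b : ℝ} (hb : 0 ≤ b) {t t₂ : ℝ} (ht : 1 ≤ t) (htt : t ≤ t₂) :
    oneLoopShape b t ≤ oneLoopShape b t₂ := by
  unfold oneLoopShape
  have h0 : 0 ≤ Real.log t := Real.log_nonneg ht
  have h1 : Real.log t ≤ Real.log t₂ := Real.log_le_log (by linarith) htt
  have ha : 0 ≤ 1 + b * Real.log t := by nlinarith
  have hab : 1 + b * Real.log t ≤ 1 + b * Real.log t₂ := by nlinarith
  exact pow_le_pow_left₀ ha hab 2

/-- The crux's inequality in the toy model, stated exactly in the crux's shape (`∃ A ≥ 1, ∀ …`). -/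
theorem scaleMonotonicity_toy {b : ℝ} (hb : 0 ≤ b) :
    ∃ A : ℝ, 1 ≤ A ∧ ∀ t t₂ : ℝ, 1 ≤ t → t ≤ t₂ → oneLoopShape b t ≤ A * oneLoopShape b t₂ :=
  ⟨1, le_rfl, fun t t₂ ht htt => by simpa using af_sign_monotone hb ht htt⟩

/-- Infrared-free sign (`b < 0`): quasi-monotonicity fails for EVERY constant `A` (take `t = 1`, `t₂ = e^{-1/b}`,
where the one-loop shape vanishes). -/
theorem irfree_sign_violates {b : ℝ} (hb : b < 0) (A : ℝ) :
    ∃ t t₂ : ℝ, 1 ≤ t ∧ t ≤ t₂ ∧ ¬ (oneLoopShape b t ≤ A * oneLoopShape b t₂) := by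
  have hpos : 0 < -1 / b := div_pos_iff.mpr (Or.inr ⟨by norm_num, hb⟩)
  refine ⟨1, Real.exp (-1 / b), le_rfl, ?_, ?_⟩
  · have := Real.add_one_le_exp (-1 / b)
    linarith
  · unfold oneLoopShape
    have hb0 : b ≠ 0 := ne_of_lt hb
    have hzero : 1 + b * Real.log (Real.exp (-1 / b)) = 0 := by
      rw [Real.log_exp]
      field_simp
      ring
    rw [hzero, Real.log_one]
    norm_num

/-- Dichotomy packaged: the toy inequality holds for some constant iff the running has the asymptotically free sign. -/
theorem scaleMonotonicity_toy_iff (b : ℝ) :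
    (∃ A : ℝ, 1 ≤ A ∧ ∀ t t₂ : ℝ, 1 ≤ t → t ≤ t₂ → oneLoopShape b t ≤ A * oneLoopShape b t₂) ↔ 0 ≤ b := by
  constructor
  · rintro ⟨A, -, hA⟩
    by_contra h
    push Not at h
    obtain ⟨t, t₂, ht, htt, hnot⟩ := irfree_sign_violates h A
    exact hnot (hA t t₂ ht htt)
  · exact scaleMonotonicity_toy

end Summit.QuantumFields.YangMills.Cruxes.ScaleMonotonicity.Rung
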